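import Summits.Langlands.Langlands.Theorems.IrreducibilityBySelfDualityIrreducibleOffSectorTransfer
import Literature.NumberTheory.Automorphic.QuadraticBaseChangeFrobCompatibleCarayolProofs
import Literature.NumberTheory.Automorphic.AlgebraicityTwist
import Literature.NumberTheory.Automorphic.ArchParameterUnique
import Literature.NumberTheory.Automorphic.BockleHuiIrreducibleGL3
import Literature.NumberTheory.Automorphic.HilbertModularGaloisRep
import Literature.NumberTheory.GaloisRepresentations.WeakAbelianDirectSummandCyclotomicProofs
import HarnessLib

/-!
# `IrreducibleOffSector` on the regular totally-real / CM sector: reduction to the irreducibility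
# of the Galois representation attached to the regular algebraic twist, and the closed regions
# `n = 3`, `K` totally real (Böckle–Hui 2025) and `n = 2`, `K` totally real (Ribet / Taylor)
(crux stmt-Langlands-14329 `IrreducibilityBySelfDuality.IrreducibleOffSector`, line `Sketch`;
`--supports` file, STRUCTURAL: no import of the route module)

The crux quantifies over every `ρ : Γ_K → GL_n(ℚ̄_ℓ)` that is Satake–Frobenius compatible with the
L-algebraic `π` at almost all places in the summit's L-normalisation
(`SatakeFrobCompatibleAt`: `det(X - ρ(Frob_v)) = ∏_j (X - ι⁻¹(α_j⁻¹)) = arithFrobPolyOfSatake ι q_v 1 α`).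
The printed existence / irreducibility theorems (Harris–Lan–Taylor–Thorne, Scholze, Varma = lang.S27;
Ribet, Taylor, Böckle–Hui) speak instead of REGULAR ALGEBRAIC (C-algebraic) `π'` and the
C-normalisation `arithFrobPolyOfSatake ι q_v n β = ∏_j (X - ι⁻¹((q_v^{(n-1)/2} β_j)⁻¹))`.  The two are
matched by the half-twist `π' = π ⊗ |det|^{(n-1)/2}` (Buzzard–Gee 2014 §5.3): `π'` is regular algebraic
when `π` is L-algebraic with a regular infinity type (`isRegularAlgebraic_of_hasInfinityType_twist_half`),
its Satake parameter at `v` is `β = q_v^{-(n-1)/2} α` (`HasSatakeParamAt.of_map_mulChar_detTwist_of_cpow`),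
and `arithFrobPolyOfSatake ι q_v n β = arithFrobPolyOfSatake ι q_v 1 α`
(`arithFrobPolyOfSatake_map_cpow_neg_half`).  Hence:

* `eventually_hasFrobCharpolyAt_common_of_twist` — an `r` compatible with `π'` at every `v ∤ ℓ`
  in the C-normalisation and a `ρ` compatible with `π` a.e. in the L-normalisation have a common
  Frobenius characteristic polynomial at almost all places;
* `isIrreducible_of_twist_attached_irreducible` — if such an `r` is irreducible, so is every such
  `ρ` (Chebotarev–Brauer–Nesbitt transfer `isIrreducible_of_eventually_hasFrobCharpolyAt_common`,
  p79199);
* `isIrreducible_of_isRegular_of_exists_irreducible_attached` — the slice of the crux at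
  `(n, K, π)` with `π` L-algebraic of regular infinity type follows from the existence of ONE
  irreducible `r` attached in the C-normalisation to each regular algebraic cuspidal `π'` on
  `GL_n(𝔸_K)` (all `n ≥ 1`, every `K`);
* `isIrreducible_of_isRegular_of_galoisRep_irreducible` — for `K` totally real or CM this
  existence is lang.S27 (the text of the route input `GaloisRepOfRegularAlgebraic`) plus the
  classical irreducibility statement for the attached semisimple representation; so on the
  regular totally-real/CM sector the crux IS the irreducibility conjecture for `r_{ℓ,ι}(π')`;
* the closed regions: `isIrreducible_rank_three_totallyReal_of_isRegular` (`n = 3`, `K` totally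
  real: Böckle–Hui 2025 Thm 1.2, the named fact `isIrreducible_galoisRep_gl3_totallyReal`) and
  `isIrreducible_rank_two_totallyReal_of_isRegular` (`n = 2`, `K` totally real: Ribet 1977 /
  Taylor 1995, the named fact `galoisRep_GL2_totallyReal_irreducible`), each modulo the lang.S27
  text only.

References: K. Buzzard, T. Gee, *The conjectural connections between automorphic representations
and Galois representations*, LMS LNS 414 (2014), §5.3; M. Harris, K.-W. Lan, R. Taylor, J. Thorne,
Res. Math. Sci. 3 (2016), Thm. A; G. Böckle, C.-Y. Hui, Math. Ann. 393 (2025), Thm. 1.2; R. Taylor,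
*On Galois representations associated to Hilbert modular forms II* (1995), Thm. 1.1; P. Deligne,
J.-P. Serre, ASENS 7 (1974), Lemme 3.2.
-/

noncomputable section

set_option linter.dupNamespace false

open scoped NumberField Classical
open Filter IsDedekindDomain NumberField
open Literature.NumberTheory.Automorphic Literature.NumberTheory.GaloisRepresentations
open Summit.Langlands

namespace Summit.Langlands.Langlands.Theorems.IrreducibleOffSector

section Bridge

variable {n : ℕ} {K : Type} [Field K] [NumberField K] {hcpt : isCompact_glFiniteIntegralLevel n K}
  {ℓ : ℕ} [Fact ℓ.Prime]

/-! ### The half-twist bridge between the two normalisations -/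

/-- **Common Frobenius polynomials across the half-twist.**  Let `π' = π ⊗ |det|^{(n-1)/2}`
(`W_{π'} = |det|^{(n-1)/2} W_π`, same for `W'`), `r` compatible with `π'` at every finite `v ∤ ℓ` in the
C-normalisation (`r` unramified with `det(X - r(Frob_v)) = arithFrobPolyOfSatake ι q_v n β` for every
Satake parameter `β` of `π'` at `v`) and `ρ` Satake–Frobenius compatible with `(π, ι)` at almost all
places (L-normalisation).  Then at almost all `v` both are unramified with a COMMON characteristic
polynomial of Frobenius: `β = q_v^{-(n-1)/2} α` and
`arithFrobPolyOfSatake ι q_v n (q_v^{-(n-1)/2} α) = arithFrobPolyOfSatake ι q_v 1 α`.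
[cite: BuzzardGeeLMS2014, §5.3] -/
theorem eventually_hasFrobCharpolyAt_common_of_twist (hn : 1 ≤ n) (ι : PadicAlgCl ℓ ≃+* ℂ)
    {π π' : AutomorphicRepData (AutomorphyDatum.gl n K hcpt)} {χ : HeckeCharacter K}
    (hχ : ∀ x : ideleGroup K,
      ((χ x : ℂˣ) : ℂ) = (ideleNorm x : ℂ) ^ ((((n : ℝ) - 1) / 2 : ℝ) : ℂ))
    (hW : π'.W = π.W.map (mulChar (detTwist n χ)))
    (hW' : π'.W' = π.W'.map (mulChar (detTwist n χ)))
    {r ρ : FramedGaloisRep K (PadicAlgCl ℓ) n}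
    (hr : ∀ (v : HeightOneSpectrum (𝓞 K)) (β : Multiset ℂ), π'.HasSatakeParamAt v β →
      ((ℓ : ℕ) : 𝓞 K) ∉ v.asIdeal →
        r.IsUnramifiedAt v ∧ r.HasFrobCharpolyAt v (arithFrobPolyOfSatake ι v.residueCard n β))
    (hρ : ∀ᶠ v : HeightOneSpectrum (𝓞 K) in cofinite, SatakeFrobCompatibleAt ι π ρ v) :
    ∀ᶠ v : HeightOneSpectrum (𝓞 K) in cofinite,
      r.IsUnramifiedAt v ∧ ρ.IsUnramifiedAt v ∧
        ∃ P : Polynomial (PadicAlgCl ℓ), r.HasFrobCharpolyAt v P ∧ ρ.HasFrobCharpolyAt v P := by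
  filter_upwards [hρ, FramedGaloisRep.eventually_natCast_not_mem K ℓ] with v hv hℓ
  obtain ⟨α, hα, hur, hcp⟩ := hv
  -- the Satake parameter of `π'` at `v` is `q_v^{-(n-1)/2} α`
  have hβ := AutomorphicRepData.HasSatakeParamAt.of_map_mulChar_detTwist_of_cpow hχ hW hW' hα
  obtain ⟨hur', hcp'⟩ := hr v _ hβ hℓ
  rw [arithFrobPolyOfSatake_map_cpow_neg_half ι (lt_trans zero_lt_one v.one_lt_residueCard) hn]
    at hcp'
  exact ⟨hur', hur, _, hcp', hcp⟩

/-- **Irreducibility crosses the half-twist.**  With `π' = π ⊗ |det|^{(n-1)/2}` as above: if some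
IRREDUCIBLE `r` is compatible with `π'` at every `v ∤ ℓ` in the C-normalisation, then every `ρ`
Satake–Frobenius compatible with `(π, ι)` at almost all places is irreducible (Chebotarev +
Brauer–Nesbitt transfer, `isIrreducible_of_eventually_hasFrobCharpolyAt_common`).
[cite: DeligneSerreASENS1974, Lemme 3.2] -/
theorem isIrreducible_of_twist_attached_irreducible (hn : 1 ≤ n) (ι : PadicAlgCl ℓ ≃+* ℂ)
    {π π' : AutomorphicRepData (AutomorphyDatum.gl n K hcpt)} {χ : HeckeCharacter K}
    (hχ : ∀ x : ideleGroup K,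
      ((χ x : ℂˣ) : ℂ) = (ideleNorm x : ℂ) ^ ((((n : ℝ) - 1) / 2 : ℝ) : ℂ))
    (hW : π'.W = π.W.map (mulChar (detTwist n χ)))
    (hW' : π'.W' = π.W'.map (mulChar (detTwist n χ)))
    {r : FramedGaloisRep K (PadicAlgCl ℓ) n} (hirr : r.toGaloisRep.IsIrreducible)
    (hr : ∀ (v : HeightOneSpectrum (𝓞 K)) (β : Multiset ℂ), π'.HasSatakeParamAt v β →
      ((ℓ : ℕ) : 𝓞 K) ∉ v.asIdeal →
        r.IsUnramifiedAt v ∧ r.HasFrobCharpolyAt v (arithFrobPolyOfSatake ι v.residueCard n β))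
    (ρ : FramedGaloisRep K (PadicAlgCl ℓ) n)
    (hρ : ∀ᶠ v : HeightOneSpectrum (𝓞 K) in cofinite, SatakeFrobCompatibleAt ι π ρ v) :
    ρ.toGaloisRep.IsIrreducible :=
  isIrreducible_of_eventually_hasFrobCharpolyAt_common hirr
    (eventually_hasFrobCharpolyAt_common_of_twist hn ι hχ hW hW' hr hρ)

/-! ### The regular slice of the crux from an irreducible attached representation -/

/-- **A regular L-algebraic infinity type.**  If `π` is L-algebraic and has SOME regular infinity
type, then it has an infinity type that is both L-algebraic and regular (regularity only reads the
`a`-multisets, which agree for all infinity types of `π`, `HasInfinityType.map_a_eq`).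
[cite: Clozel1990, §3.3] -/
theorem exists_infinityType_isLAlgebraic_isRegular
    (π : AutomorphicRepData (AutomorphyDatum.gl n K hcpt)) (hL : π.IsLAlgebraic)
    (hreg : ∃ T : InfinityType K n, π.HasInfinityType T ∧ T.IsRegular) :
    ∃ T : InfinityType K n, π.HasInfinityType T ∧ T.IsLAlgebraic ∧ T.IsRegular := by
  obtain ⟨T₁, hT₁, hL₁⟩ := hL
  obtain ⟨T₂, hT₂, hR₂⟩ := hreg
  refine ⟨T₁, hT₁, hL₁, fun σ => ?_⟩
  rw [AutomorphicRepData.HasInfinityType.map_a_eq π hT₁ hT₂ σ]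
  exact hR₂ σ

/-- **The regular slice of `IrreducibleOffSector` from ONE irreducible attached representation per
regular algebraic `π'`** (every `n ≥ 1`, every number field `K`).  Suppose every regular algebraic
cuspidal `π'` on `GL_n(𝔸_K)` admits, for the given `ℓ, ι`, an irreducible `r : Γ_K → GL_n(ℚ̄_ℓ)`
compatible with `π'` at every `v ∤ ℓ` in the C-normalisation `arithFrobPolyOfSatake ι q_v n β`.  Then
for every cuspidal `π` on `GL_n(𝔸_K)` that is L-algebraic with a regular infinity type, every `ρ`
Satake–Frobenius compatible with `(π, ι)` at almost all places is irreducible: apply the hypothesis to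
the regular algebraic twist `π' = π ⊗ |det|^{(n-1)/2}` (`exists_twist_hasInfinityType`,
`isRegularAlgebraic_of_hasInfinityType_twist_half`) and cross the half-twist
(`isIrreducible_of_twist_attached_irreducible`). [cite: BuzzardGeeLMS2014, §5.3] -/
theorem isIrreducible_of_isRegular_of_exists_irreducible_attached [NeZero n] (ι : PadicAlgCl ℓ ≃+* ℂ)
    (hex : ∀ π' : CuspidalAutomorphicRepData n K hcpt, π'.1.IsRegularAlgebraic →
      ∃ r : FramedGaloisRep K (PadicAlgCl ℓ) n, r.toGaloisRep.IsIrreducible ∧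
        ∀ (v : HeightOneSpectrum (𝓞 K)) (β : Multiset ℂ), π'.1.HasSatakeParamAt v β →
          ((ℓ : ℕ) : 𝓞 K) ∉ v.asIdeal →
            r.IsUnramifiedAt v ∧ r.HasFrobCharpolyAt v (arithFrobPolyOfSatake ι v.residueCard n β))
    (π : CuspidalAutomorphicRepData n K hcpt) (hL : π.1.IsLAlgebraic)
    (hreg : ∃ T : InfinityType K n, π.1.HasInfinityType T ∧ T.IsRegular)
    (ρ : FramedGaloisRep K (PadicAlgCl ℓ) n)
    (hρ : ∀ᶠ v : HeightOneSpectrum (𝓞 K) in cofinite, SatakeFrobCompatibleAt ι π.1 ρ v) :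
    ρ.toGaloisRep.IsIrreducible := by
  obtain ⟨T, hT, hTL, hTR⟩ := exists_infinityType_isLAlgebraic_isRegular π.1 hL hreg
  -- the regular algebraic twist `π' = π ⊗ |det|^{(n-1)/2}`
  obtain ⟨χ, π', hχ, hW, hW', hT'⟩ := π.exists_twist_hasInfinityType (((n : ℝ) - 1) / 2) hT
  have hRA : π'.1.IsRegularAlgebraic :=
    isRegularAlgebraic_of_hasInfinityType_twist_half (by exact_mod_cast hT') hTL hTR
  obtain ⟨r, hirr, hr⟩ := hex π' hRA
  exact isIrreducible_of_twist_attached_irreducible NeZero.one_le ι hχ hW hW' hirr hr ρ hρ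

end Bridge

/-! ### The regular totally-real / CM sector (registered sub-goals of the lead, closed telescopes) -/

/-- **On the regular totally-real / CM sector the crux is the irreducibility of `r_{ℓ,ι}(π')`.**
Grant lang.S27 (Harris–Lan–Taylor–Thorne / Scholze / Varma: the text of the route input
`GaloisRepOfRegularAlgebraic`, explicit binders) and the irreducibility of every semisimple `r`
compatible in the C-normalisation with a regular algebraic cuspidal `π'` on `GL_n(𝔸_K)` (the shape of
the tree's irreducibility facts `isIrreducible_galoisRep_gl3_totallyReal`,
`galoisRep_GL2_totallyReal_irreducible`).  Then for `K` totally real or CM and `π` cuspidal on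
`GL_n(𝔸_K)`, L-algebraic with a regular infinity type, every `ρ` Satake–Frobenius compatible with
`(π, ι)` at almost all places is irreducible.
[cite: HarrisLanTaylorThorneRMS2016, Thm. A] [cite: BuzzardGeeLMS2014, §5.3] -/
theorem isIrreducible_of_isRegular_of_galoisRep_irreducible
    (hGR : ∀ (n : ℕ) (K : Type) [Field K] [NumberField K] (hcpt : Literature.NumberTheory.Automorphic.isCompact_glFiniteIntegralLevel n K), (NumberField.IsTotallyReal K ∨ NumberField.IsCMField K) → ∀ (π : Literature.NumberTheory.Automorphic.CuspidalAutomorphicRepData n K hcpt), π.1.IsRegularAlgebraic → ∀ (ℓ : ℕ) [Fact ℓ.Prime] (ι : PadicAlgCl ℓ ≃+* ℂ), ∃ r : Literature.NumberTheory.GaloisRepresentations.FramedGaloisRep K (PadicAlgCl ℓ) n, r.toGaloisRep.IsSemisimple ∧ ∀ (v : IsDedekindDomain.HeightOneSpectrum (NumberField.RingOfIntegers K)) (α : Multiset ℂ), π.1.HasSatakeParamAt v α → ((ℓ : ℕ) : NumberField.RingOfIntegers K) ∉ v.asIdeal → r.IsUnramifiedAt v ∧ r.HasFrobCharpolyAt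 v (Literature.NumberTheory.Automorphic.arithFrobPolyOfSatake ι v.residueCard n α))
    {n : ℕ} [NeZero n] {K : Type} [Field K] [NumberField K] (hK : IsTotallyReal K ∨ IsCMField K)
    {hcpt : isCompact_glFiniteIntegralLevel n K} {ℓ : ℕ} [Fact ℓ.Prime] (ι : PadicAlgCl ℓ ≃+* ℂ)
    (hirr : ∀ π' : CuspidalAutomorphicRepData n K hcpt, π'.1.IsRegularAlgebraic →
      ∀ r : FramedGaloisRep K (PadicAlgCl ℓ) n, r.toGaloisRep.IsSemisimple →
        (∀ (v : HeightOneSpectrum (𝓞 K)) (β : Multiset ℂ), π'.1.HasSatakeParamAt v β →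
          ((ℓ : ℕ) : 𝓞 K) ∉ v.asIdeal →
            r.IsUnramifiedAt v ∧ r.HasFrobCharpolyAt v (arithFrobPolyOfSatake ι v.residueCard n β)) →
        r.toGaloisRep.IsIrreducible)
    (π : CuspidalAutomorphicRepData n K hcpt) (hL : π.1.IsLAlgebraic)
    (hreg : ∃ T : InfinityType K n, π.1.HasInfinityType T ∧ T.IsRegular)
    (ρ : FramedGaloisRep K (PadicAlgCl ℓ) n)
    (hρ : ∀ᶠ v : HeightOneSpectrum (𝓞 K) in cofinite, SatakeFrobCompatibleAt ι π.1 ρ v) :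
    ρ.toGaloisRep.IsIrreducible := by
  refine isIrreducible_of_isRegular_of_exists_irreducible_attached ι (fun π' hRA => ?_) π hL hreg ρ hρ
  obtain ⟨r, hss, hr⟩ := hGR n K hcpt hK π' hRA ℓ ι
  exact ⟨r, hirr π' hRA r hss hr, hr⟩

/-! ### Closed regions of the crux -/

/-- **`IrreducibleOffSector` for `n = 3` over totally real fields, regular `π`** (a child of the
crux; Böckle–Hui 2025, Thm. 1.2).  Grant lang.S27 (the text of the route input
`GaloisRepOfRegularAlgebraic`) and Böckle–Hui's theorem (the named fact
`isIrreducible_galoisRep_gl3_totallyReal`).  For `K` totally real, `π` cuspidal on `GL_3(𝔸_K)`,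
L-algebraic with a regular infinity type, every `ℓ`, `ι` and every `ρ : Γ_K → GL_3(ℚ̄_ℓ)`
Satake–Frobenius compatible with `(π, ι)` at almost all places, `ρ` is irreducible.  (Totally real
fields are not CM, so this region lies off the sector `n = 3 ∧ K CM ∧ regular`.)
[cite: BockleHui2025, Theorem 1.2] [cite: HarrisLanTaylorThorneRMS2016, Thm. A] -/
theorem isIrreducible_rank_three_totallyReal_of_isRegular
    (hGR : ∀ (n : ℕ) (K : Type) [Field K] [NumberField K] (hcpt : Literature.NumberTheory.Automorphic.isCompact_glFiniteIntegralLevel n K), (NumberField.IsTotallyReal K ∨ NumberField.IsCMField K) → ∀ (π : Literature.NumberTheory.Automorphic.CuspidalAutomorphicRepData n K hcpt), π.1.IsRegularAlgebraic → ∀ (ℓ : ℕ) [Fact ℓ.Prime] (ι : PadicAlgCl ℓ ≃+* ℂ), ∃ r : Literature.NumberTheory.GaloisRepresentations.FramedGaloisRep K (PadicAlgCl ℓ) n, r.toGaloisRep.IsSemisimple ∧ ∀ (v : IsDedekindDomain.HeightOneSpectrum (NumberField.RingOfIntegers K)) (α : Multiset ℂ), π.1.HasSatakeParamAt v α → ((ℓ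 : ℕ) : NumberField.RingOfIntegers K) ∉ v.asIdeal → r.IsUnramifiedAt v ∧ r.HasFrobCharpolyAt v (Literature.NumberTheory.Automorphic.arithFrobPolyOfSatake ι v.residueCard n α))
    (hBH : isIrreducible_galoisRep_gl3_totallyReal)
    {K : Type} [Field K] [NumberField K] (hK : IsTotallyReal K)
    {hcpt : isCompact_glFiniteIntegralLevel 3 K}
    (π : CuspidalAutomorphicRepData 3 K hcpt) (hL : π.1.IsLAlgebraic)
    (hreg : ∃ T : InfinityType K 3, π.1.HasInfinityType T ∧ T.IsRegular)
    {ℓ : ℕ} [Fact ℓ.Prime] (ι : PadicAlgCl ℓ ≃+* ℂ) (ρ : FramedGaloisRep K (PadicAlgCl ℓ) 3)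
    (hρ : ∀ᶠ v : HeightOneSpectrum (𝓞 K) in cofinite, SatakeFrobCompatibleAt ι π.1 ρ v) :
    ρ.toGaloisRep.IsIrreducible :=
  haveI : NeZero (3 : ℕ) := ⟨three_ne_zero⟩
  isIrreducible_of_isRegular_of_galoisRep_irreducible hGR (Or.inl hK) ι
    (fun π' hRA r hss hr => hBH K hK hcpt π' hRA ℓ ι r hss hr) π hL hreg ρ hρ

/-- **`IrreducibleOffSector` for `n = 2` over totally real fields, regular `π`** (a child of the
crux; Ribet 1977 / Taylor 1995: irreducibility of the Galois representation of a cuspidal Hilbert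
eigenform of paritious weight `≥ 2`).  Grant lang.S27 (the text of the route input
`GaloisRepOfRegularAlgebraic`) and the named fact `galoisRep_GL2_totallyReal_irreducible`.  For `K`
totally real, `π` cuspidal on `GL_2(𝔸_K)`, L-algebraic with a regular infinity type, every `ℓ`, `ι`
and every `ρ : Γ_K → GL_2(ℚ̄_ℓ)` Satake–Frobenius compatible with `(π, ι)` at almost all places, `ρ`
is irreducible.  (The sibling `isIrreducible_rank_two_of_isRegular`, p113499, covers every `K`
modulo Jacquet–Shalika and Clozel's Hecke field instead.)
[cite: Taylor1995HMFII, Thm. 1.1] [cite: HarrisLanTaylorThorneRMS2016, Thm. A] -/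
theorem isIrreducible_rank_two_totallyReal_of_isRegular
    (hGR : ∀ (n : ℕ) (K : Type) [Field K] [NumberField K] (hcpt : Literature.NumberTheory.Automorphic.isCompact_glFiniteIntegralLevel n K), (NumberField.IsTotallyReal K ∨ NumberField.IsCMField K) → ∀ (π : Literature.NumberTheory.Automorphic.CuspidalAutomorphicRepData n K hcpt), π.1.IsRegularAlgebraic → ∀ (ℓ : ℕ) [Fact ℓ.Prime] (ι : PadicAlgCl ℓ ≃+* ℂ), ∃ r : Literature.NumberTheory.GaloisRepresentations.FramedGaloisRep K (PadicAlgCl ℓ) n, r.toGaloisRep.IsSemisimple ∧ ∀ (v : IsDedekindDomain.HeightOneSpectrum (NumberField.RingOfIntegers K)) (α : Multiset ℂ), π.1.HasSatakeParamAt v α → ((ℓ : ℕ) : NumberField.RingOfIntegers K) ∉ v.asIdeal → r.IsUnramifiedAt v ∧ r.HasFrobCharpolyAt v (Literature.NumberTheory.Automorphic.arithFrobPolyOfSatake ι v.residueCard n α))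
    (h2 : galoisRep_GL2_totallyReal_irreducible)
    {K : Type} [Field K] [NumberField K] (hK : IsTotallyReal K)
    {hcpt : isCompact_glFiniteIntegralLevel 2 K}
    (π : CuspidalAutomorphicRepData 2 K hcpt) (hL : π.1.IsLAlgebraic)
    (hreg : ∃ T : InfinityType K 2, π.1.HasInfinityType T ∧ T.IsRegular)
    {ℓ : ℕ} [Fact ℓ.Prime] (ι : PadicAlgCl ℓ ≃+* ℂ) (ρ : FramedGaloisRep K (PadicAlgCl ℓ) 2)
    (hρ : ∀ᶠ v : HeightOneSpectrum (𝓞 K) in cofinite, SatakeFrobCompatibleAt ι π.1 ρ v) :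
    ρ.toGaloisRep.IsIrreducible :=
  haveI : NeZero (2 : ℕ) := ⟨two_ne_zero⟩
  isIrreducible_of_isRegular_of_galoisRep_irreducible hGR (Or.inl hK) ι
    (fun π' hRA r _ hr => h2 hcpt hK π' hRA ℓ ι r fun v hv β hβ => hr v β hβ hv) π hL hreg ρ hρ

end Summit.Langlands.Langlands.Theorems.IrreducibleOffSector

end
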